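import Summits.HubbardSuperconductivity.HubbardSuperconductivity.Theorems.BalabanIRBirBdGPhaseCoercivityTrigPoly

/-!
# Route BalabanIR — crux 3 `BirBdGPhaseCoercivity` (item `stmt-HubbardSuperconductivity-2081`):
# XIV. Polynomial approximants of `1/E` in the variable `E²`: the approximation datum (A) from a
# one-variable bound

The datum (A) of `BirBdG.symbolIneq_dplusid_of_realData` asks for a trigonometric polynomial
`m = Σ_ρ a_ρ e^{iρ·θ}` with `|1/E(θ) - m(θ)| ≤ δ` on `ℝ²`. Since `E(θ)² = ξ(θ)² + |Δ(θ)|²` is itself a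
trigonometric polynomial (of coordinate degree `2`), any real polynomial `P` with
`|y^{-1/2} - P(y)| ≤ δ` on an interval `[lo, hi] ∋ E(θ)²` gives such an `m := P(E²)`, of degree
`2·deg P`. This file makes that precise in the group algebra `ℂ[ℤ²]` (`AddMonoidAlgebra ℂ (ℤ × ℤ)`):
* `evalAlgHom_*` — evaluation at angles `θ` is the algebra homomorphism `lift` of the character
  `ρ ↦ e^{iρ·θ}`; its value on the explicit element `E2A μ Δ₁ Δ₂` (written out) is `E(θ)²`;
* `approx_of_polynomial` — (A) for `a := (aeval E2A (P.map ofReal)).coeff` from the one-variable bound;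
* `support_aeval_E2A_subset` — `supp a ⊆ [-2 deg P, 2 deg P]²`.

References: evidence notes on the item (two-layer reduction, proof scheme). No definition is introduced
(the elements of `ℂ[ℤ²]` are explicit sums of `single`s).
-/

noncomputable section

namespace Summit.HubbardSuperconductivity.HubbardSuperconductivity.Theorems

namespace BirBdG

open Finset AddMonoidAlgebra
open scoped ComplexConjugate

/-! ### The evaluation character at angles `θ` -/

/-- The additive character `ρ ↦ e^{i(ρ₀θ₀ + ρ₁θ₁)}` of `ℤ²`. [folklore] -/
theorem exists_angleChar (θ₀ θ₁ : ℝ) :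
    ∃ F : Multiplicative (ℤ × ℤ) →* ℂ, ∀ ρ : ℤ × ℤ,
      F (Multiplicative.ofAdd ρ) = Complex.exp (Complex.I * ((ρ.1 * θ₀ + ρ.2 * θ₁ : ℝ) : ℂ)) := by
  let ψ : AddChar (ℤ × ℤ) ℂ :=
    { toFun := fun ρ => Complex.exp (Complex.I * ((ρ.1 * θ₀ + ρ.2 * θ₁ : ℝ) : ℂ))
      map_zero_eq_one' := by simp
      map_add_eq_mul' := by
        intro ρ σ
        rw [← Complex.exp_add]
        congr 1
        simp only [Prod.fst_add, Prod.snd_add]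
        push_cast
        ring }
  exact ⟨AddChar.toMonoidHomEquiv ψ, fun ρ => rfl⟩

/-- Evaluation of an element of `ℂ[ℤ²]` by `lift` of the angle character is the explicit exponential sum
over the support of its coefficients. [folklore] -/
theorem lift_eq_sum_support (F : Multiplicative (ℤ × ℤ) →* ℂ) (f : AddMonoidAlgebra ℂ (ℤ × ℤ)) :
    AddMonoidAlgebra.lift ℂ ℂ (ℤ × ℤ) F f = ∑ ρ ∈ f.coeff.support, f.coeff ρ * F (Multiplicative.ofAdd ρ) := by
  rw [AddMonoidAlgebra.lift_apply']
  rfl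

/-! ### The element `E2A` of `ℂ[ℤ²]` representing `E(θ)² = ξ(θ)² + |Δ(θ)|²`, and its evaluation -/

/-- **Evaluation of `E2A`**: under `lift` of the angle character, the explicit element
`ξA·ξA + ΔA·ΔA⋆` of `ℂ[ℤ²]` (`ξA = -μ - e^{±iθ₀} - e^{±iθ₁}` terms, `ΔA = Σ_{r∈B} c_r [r]`,
`ΔA⋆ = Σ_{r∈B} conj(c_r) [-r]`) evaluates to `ξ(θ)² + |Δ(θ)|²`. [folklore] -/
theorem lift_E2A (μ Δ₁ Δ₂ θ₀ θ₁ : ℝ) (F : Multiplicative (ℤ × ℤ) →* ℂ)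
    (hF : ∀ ρ : ℤ × ℤ, F (Multiplicative.ofAdd ρ) = Complex.exp (Complex.I * ((ρ.1 * θ₀ + ρ.2 * θ₁ : ℝ) : ℂ))) :
    AddMonoidAlgebra.lift ℂ ℂ (ℤ × ℤ) F ((AddMonoidAlgebra.single ((0 : ℤ), (0 : ℤ)) (-(μ : ℂ)) - AddMonoidAlgebra.single ((1 : ℤ), (0 : ℤ)) (1 : ℂ)
          - AddMonoidAlgebra.single ((-1 : ℤ), (0 : ℤ)) (1 : ℂ) - AddMonoidAlgebra.single ((0 : ℤ), (1 : ℤ)) (1 : ℂ)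
          - AddMonoidAlgebra.single ((0 : ℤ), (-1 : ℤ)) (1 : ℂ)) *
        (AddMonoidAlgebra.single ((0 : ℤ), (0 : ℤ)) (-(μ : ℂ)) - AddMonoidAlgebra.single ((1 : ℤ), (0 : ℤ)) (1 : ℂ)
          - AddMonoidAlgebra.single ((-1 : ℤ), (0 : ℤ)) (1 : ℂ) - AddMonoidAlgebra.single ((0 : ℤ), (1 : ℤ)) (1 : ℂ)
          - AddMonoidAlgebra.single ((0 : ℤ), (-1 : ℤ)) (1 : ℂ)) +
        (∑ r ∈ ({(1, 0), (-1, 0), (0, 1), (0, -1), (1, 1), (-1, -1), (1, -1), (-1, 1)} : Finset (ℤ × ℤ)), AddMonoidAlgebra.single r ((fun r : ℤ × ℤ => if (r = (1, 0) ∨ r = (-1, 0)) then (Δ₁ : ℂ) else if (r = (0, 1) ∨ r = (0, -1)) then -(Δ₁ : ℂ)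
          else if (r = (1, 1) ∨ r = (-1, -1)) then Complex.I * (Δ₂ : ℂ) else -(Complex.I * (Δ₂ : ℂ))) r)) *
        (∑ r ∈ ({(1, 0), (-1, 0), (0, 1), (0, -1), (1, 1), (-1, -1), (1, -1), (-1, 1)} : Finset (ℤ × ℤ)), AddMonoidAlgebra.single (-r) (conj ((fun r : ℤ × ℤ => if (r = (1, 0) ∨ r = (-1, 0)) then (Δ₁ : ℂ) else if (r = (0, 1) ∨ r = (0, -1)) then -(Δ₁ : ℂ)
          else if (r = (1, 1) ∨ r = (-1, -1)) then Complex.I * (Δ₂ : ℂ) else -(Complex.I * (Δ₂ : ℂ))) r)))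
        : AddMonoidAlgebra ℂ (ℤ × ℤ)) =
      ((((-2 * Real.cos θ₀ - 2 * Real.cos θ₁ - μ) ^ 2 +
        ‖((2 * Δ₁ * (Real.cos θ₀ - Real.cos θ₁) : ℝ) : ℂ) -
          4 * Complex.I * ((Δ₂ * Real.sin θ₀ * Real.sin θ₁ : ℝ) : ℂ)‖ ^ 2 : ℝ)) : ℂ) := by
  -- evaluation of the three building blocks
  have hξ : AddMonoidAlgebra.lift ℂ ℂ (ℤ × ℤ) F
      (AddMonoidAlgebra.single ((0 : ℤ), (0 : ℤ)) (-(μ : ℂ)) - AddMonoidAlgebra.single ((1 : ℤ), (0 : ℤ)) (1 : ℂ)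
          - AddMonoidAlgebra.single ((-1 : ℤ), (0 : ℤ)) (1 : ℂ) - AddMonoidAlgebra.single ((0 : ℤ), (1 : ℤ)) (1 : ℂ)
          - AddMonoidAlgebra.single ((0 : ℤ), (-1 : ℤ)) (1 : ℂ)) =
      (((-2 * Real.cos θ₀ - 2 * Real.cos θ₁ - μ) : ℝ) : ℂ) := by
    simp only [map_sub, AddMonoidAlgebra.lift_single, smul_eq_mul]
    have h0 : F (Multiplicative.ofAdd ((0 : ℤ), (0 : ℤ))) = 1 := by
      rw [show ((0 : ℤ), (0 : ℤ)) = (0 : ℤ × ℤ) from rfl, ofAdd_zero, map_one]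
    rw [h0, hF, hF, hF, hF]
    have hexp : ∀ x : ℂ, Complex.exp (Complex.I * x) = Complex.cos x + Complex.sin x * Complex.I := fun x => by
      rw [mul_comm, Complex.exp_mul_I]
    have hexp' : ∀ x : ℂ, Complex.exp (-(Complex.I * x)) = Complex.cos x - Complex.sin x * Complex.I := fun x => by
      rw [← mul_neg, hexp, Complex.cos_neg, Complex.sin_neg]
      ring
    push_cast
    simp only [one_mul, neg_mul, zero_mul, add_zero, zero_add, mul_neg]
    simp only [hexp, hexp']
    ring
  have hΔ : AddMonoidAlgebra.lift ℂ ℂ (ℤ × ℤ) F (∑ r ∈ ({(1, 0), (-1, 0), (0, 1), (0, -1), (1, 1), (-1, -1), (1, -1), (-1, 1)} : Finset (ℤ × ℤ)), AddMonoidAlgebra.single r ((fun r : ℤ × ℤ => if (r = (1, 0) ∨ r = (-1, 0)) then (Δ₁ : ℂ) else if (r = (0, 1) ∨ r = (0, -1)) then -(Δ₁ : ℂ)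
          else if (r = (1, 1) ∨ r = (-1, -1)) then Complex.I * (Δ₂ : ℂ) else -(Complex.I * (Δ₂ : ℂ))) r)) =
      ((2 * Δ₁ * (Real.cos θ₀ - Real.cos θ₁) : ℝ) : ℂ) - 4 * Complex.I * ((Δ₂ * Real.sin θ₀ * Real.sin θ₁ : ℝ) : ℂ) := by
    rw [map_sum, gap_eq_sum_bondCoeff_mul_exp]
    refine Finset.sum_congr rfl fun r _ => ?_
    rw [AddMonoidAlgebra.lift_single, smul_eq_mul, hF]
  have hΔs : AddMonoidAlgebra.lift ℂ ℂ (ℤ × ℤ) F (∑ r ∈ ({(1, 0), (-1, 0), (0, 1), (0, -1), (1, 1), (-1, -1), (1, -1), (-1, 1)} : Finset (ℤ × ℤ)), AddMonoidAlgebra.single (-r) (conj ((fun r : ℤ × ℤ => if (r = (1, 0) ∨ r = (-1, 0)) then (Δ₁ : ℂ) else if (r = (0, 1) ∨ r = (0, -1)) then -(Δ₁ : ℂ)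
          else if (r = (1, 1) ∨ r = (-1, -1)) then Complex.I * (Δ₂ : ℂ) else -(Complex.I * (Δ₂ : ℂ))) r))) =
      conj (((2 * Δ₁ * (Real.cos θ₀ - Real.cos θ₁) : ℝ) : ℂ) - 4 * Complex.I * ((Δ₂ * Real.sin θ₀ * Real.sin θ₁ : ℝ) : ℂ)) := by
    rw [map_sum, gap_eq_sum_bondCoeff_mul_exp, map_sum]
    refine Finset.sum_congr rfl fun r _ => ?_
    rw [AddMonoidAlgebra.lift_single, smul_eq_mul, hF, map_mul, ← Complex.exp_conj, map_mul, Complex.conj_I,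
      Complex.conj_ofReal]
    congr 1
    simp only [Prod.fst_neg, Prod.snd_neg]
    push_cast
    ring_nf
  rw [map_add, map_mul, map_mul, hξ, hΔ, hΔs, Complex.mul_conj, Complex.normSq_eq_norm_sq]
  push_cast
  ring

/-- **The approximation datum (A) from a one-variable polynomial bound.** If `P : ℝ[X]` satisfies
`|y^{-1/2} - P(y)| ≤ δ` on `[lo, hi]` and `E(θ)² = ξ(θ)² + |Δ(θ)|² ∈ [lo, hi]` for all angles, then the
coefficients `a := (aeval E2A (P.map ofReal)).coeff` of `P(E²)` in `ℂ[ℤ²]` satisfy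
`|1/E(θ) - Σ_ρ a_ρ e^{iρ·θ}| ≤ δ` on `ℝ²` — hypothesis (A) of `BirBdG.symbolIneq_dplusid_of_realData`. [folklore] -/
theorem approx_of_polynomial (P : Polynomial ℝ) (lo hi δ μ Δ₁ Δ₂ : ℝ)
    (hP : ∀ y ∈ Set.Icc lo hi, |(Real.sqrt y)⁻¹ - P.eval y| ≤ δ)
    (hrange : ∀ θ₀ θ₁ : ℝ, (-2 * Real.cos θ₀ - 2 * Real.cos θ₁ - μ) ^ 2 +
        ‖((2 * Δ₁ * (Real.cos θ₀ - Real.cos θ₁) : ℝ) : ℂ) -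
          4 * Complex.I * ((Δ₂ * Real.sin θ₀ * Real.sin θ₁ : ℝ) : ℂ)‖ ^ 2 ∈ Set.Icc lo hi)
    (θ₀ θ₁ : ℝ) :
    ‖(((Real.sqrt ((-2 * Real.cos θ₀ - 2 * Real.cos θ₁ - μ) ^ 2 +
        ‖((2 * Δ₁ * (Real.cos θ₀ - Real.cos θ₁) : ℝ) : ℂ) -
          4 * Complex.I * ((Δ₂ * Real.sin θ₀ * Real.sin θ₁ : ℝ) : ℂ)‖ ^ 2))⁻¹ : ℝ) : ℂ) -
      ∑ ρ ∈ (Polynomial.aeval ((AddMonoidAlgebra.single ((0 : ℤ), (0 : ℤ)) (-(μ : ℂ)) - AddMonoidAlgebra.single ((1 : ℤ), (0 : ℤ)) (1 : ℂ)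
          - AddMonoidAlgebra.single ((-1 : ℤ), (0 : ℤ)) (1 : ℂ) - AddMonoidAlgebra.single ((0 : ℤ), (1 : ℤ)) (1 : ℂ)
          - AddMonoidAlgebra.single ((0 : ℤ), (-1 : ℤ)) (1 : ℂ)) *
        (AddMonoidAlgebra.single ((0 : ℤ), (0 : ℤ)) (-(μ : ℂ)) - AddMonoidAlgebra.single ((1 : ℤ), (0 : ℤ)) (1 : ℂ)
          - AddMonoidAlgebra.single ((-1 : ℤ), (0 : ℤ)) (1 : ℂ) - AddMonoidAlgebra.single ((0 : ℤ), (1 : ℤ)) (1 : ℂ)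
          - AddMonoidAlgebra.single ((0 : ℤ), (-1 : ℤ)) (1 : ℂ)) +
        (∑ r ∈ ({(1, 0), (-1, 0), (0, 1), (0, -1), (1, 1), (-1, -1), (1, -1), (-1, 1)} : Finset (ℤ × ℤ)), AddMonoidAlgebra.single r ((fun r : ℤ × ℤ => if (r = (1, 0) ∨ r = (-1, 0)) then (Δ₁ : ℂ) else if (r = (0, 1) ∨ r = (0, -1)) then -(Δ₁ : ℂ)
          else if (r = (1, 1) ∨ r = (-1, -1)) then Complex.I * (Δ₂ : ℂ) else -(Complex.I * (Δ₂ : ℂ))) r)) *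
        (∑ r ∈ ({(1, 0), (-1, 0), (0, 1), (0, -1), (1, 1), (-1, -1), (1, -1), (-1, 1)} : Finset (ℤ × ℤ)), AddMonoidAlgebra.single (-r) (conj ((fun r : ℤ × ℤ => if (r = (1, 0) ∨ r = (-1, 0)) then (Δ₁ : ℂ) else if (r = (0, 1) ∨ r = (0, -1)) then -(Δ₁ : ℂ)
          else if (r = (1, 1) ∨ r = (-1, -1)) then Complex.I * (Δ₂ : ℂ) else -(Complex.I * (Δ₂ : ℂ))) r)))
        : AddMonoidAlgebra ℂ (ℤ × ℤ)) (P.map (algebraMap ℝ ℂ))).coeff.support,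
        (Polynomial.aeval ((AddMonoidAlgebra.single ((0 : ℤ), (0 : ℤ)) (-(μ : ℂ)) - AddMonoidAlgebra.single ((1 : ℤ), (0 : ℤ)) (1 : ℂ)
          - AddMonoidAlgebra.single ((-1 : ℤ), (0 : ℤ)) (1 : ℂ) - AddMonoidAlgebra.single ((0 : ℤ), (1 : ℤ)) (1 : ℂ)
          - AddMonoidAlgebra.single ((0 : ℤ), (-1 : ℤ)) (1 : ℂ)) *
        (AddMonoidAlgebra.single ((0 : ℤ), (0 : ℤ)) (-(μ : ℂ)) - AddMonoidAlgebra.single ((1 : ℤ), (0 : ℤ)) (1 : ℂ)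
          - AddMonoidAlgebra.single ((-1 : ℤ), (0 : ℤ)) (1 : ℂ) - AddMonoidAlgebra.single ((0 : ℤ), (1 : ℤ)) (1 : ℂ)
          - AddMonoidAlgebra.single ((0 : ℤ), (-1 : ℤ)) (1 : ℂ)) +
        (∑ r ∈ ({(1, 0), (-1, 0), (0, 1), (0, -1), (1, 1), (-1, -1), (1, -1), (-1, 1)} : Finset (ℤ × ℤ)), AddMonoidAlgebra.single r ((fun r : ℤ × ℤ => if (r = (1, 0) ∨ r = (-1, 0)) then (Δ₁ : ℂ) else if (r = (0, 1) ∨ r = (0, -1)) then -(Δ₁ : ℂ)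
          else if (r = (1, 1) ∨ r = (-1, -1)) then Complex.I * (Δ₂ : ℂ) else -(Complex.I * (Δ₂ : ℂ))) r)) *
        (∑ r ∈ ({(1, 0), (-1, 0), (0, 1), (0, -1), (1, 1), (-1, -1), (1, -1), (-1, 1)} : Finset (ℤ × ℤ)), AddMonoidAlgebra.single (-r) (conj ((fun r : ℤ × ℤ => if (r = (1, 0) ∨ r = (-1, 0)) then (Δ₁ : ℂ) else if (r = (0, 1) ∨ r = (0, -1)) then -(Δ₁ : ℂ)
          else if (r = (1, 1) ∨ r = (-1, -1)) then Complex.I * (Δ₂ : ℂ) else -(Complex.I * (Δ₂ : ℂ))) r)))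
        : AddMonoidAlgebra ℂ (ℤ × ℤ)) (P.map (algebraMap ℝ ℂ))).coeff ρ *
          Complex.exp (Complex.I * ((ρ.1 * θ₀ + ρ.2 * θ₁ : ℝ) : ℂ))‖ ≤ δ := by
  obtain ⟨F, hF⟩ := exists_angleChar θ₀ θ₁
  set y : ℝ := (-2 * Real.cos θ₀ - 2 * Real.cos θ₁ - μ) ^ 2 +
        ‖((2 * Δ₁ * (Real.cos θ₀ - Real.cos θ₁) : ℝ) : ℂ) -
          4 * Complex.I * ((Δ₂ * Real.sin θ₀ * Real.sin θ₁ : ℝ) : ℂ)‖ ^ 2 with hy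
  have hEv : AddMonoidAlgebra.lift ℂ ℂ (ℤ × ℤ) F ((AddMonoidAlgebra.single ((0 : ℤ), (0 : ℤ)) (-(μ : ℂ)) - AddMonoidAlgebra.single ((1 : ℤ), (0 : ℤ)) (1 : ℂ)
          - AddMonoidAlgebra.single ((-1 : ℤ), (0 : ℤ)) (1 : ℂ) - AddMonoidAlgebra.single ((0 : ℤ), (1 : ℤ)) (1 : ℂ)
          - AddMonoidAlgebra.single ((0 : ℤ), (-1 : ℤ)) (1 : ℂ)) *
        (AddMonoidAlgebra.single ((0 : ℤ), (0 : ℤ)) (-(μ : ℂ)) - AddMonoidAlgebra.single ((1 : ℤ), (0 : ℤ)) (1 : ℂ)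
          - AddMonoidAlgebra.single ((-1 : ℤ), (0 : ℤ)) (1 : ℂ) - AddMonoidAlgebra.single ((0 : ℤ), (1 : ℤ)) (1 : ℂ)
          - AddMonoidAlgebra.single ((0 : ℤ), (-1 : ℤ)) (1 : ℂ)) +
        (∑ r ∈ ({(1, 0), (-1, 0), (0, 1), (0, -1), (1, 1), (-1, -1), (1, -1), (-1, 1)} : Finset (ℤ × ℤ)), AddMonoidAlgebra.single r ((fun r : ℤ × ℤ => if (r = (1, 0) ∨ r = (-1, 0)) then (Δ₁ : ℂ) else if (r = (0, 1) ∨ r = (0, -1)) then -(Δ₁ : ℂ)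
          else if (r = (1, 1) ∨ r = (-1, -1)) then Complex.I * (Δ₂ : ℂ) else -(Complex.I * (Δ₂ : ℂ))) r)) *
        (∑ r ∈ ({(1, 0), (-1, 0), (0, 1), (0, -1), (1, 1), (-1, -1), (1, -1), (-1, 1)} : Finset (ℤ × ℤ)), AddMonoidAlgebra.single (-r) (conj ((fun r : ℤ × ℤ => if (r = (1, 0) ∨ r = (-1, 0)) then (Δ₁ : ℂ) else if (r = (0, 1) ∨ r = (0, -1)) then -(Δ₁ : ℂ)
          else if (r = (1, 1) ∨ r = (-1, -1)) then Complex.I * (Δ₂ : ℂ) else -(Complex.I * (Δ₂ : ℂ))) r)))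
        : AddMonoidAlgebra ℂ (ℤ × ℤ)) = ((y : ℝ) : ℂ) := lift_E2A μ Δ₁ Δ₂ θ₀ θ₁ F hF
  have hsum : ∑ ρ ∈ (Polynomial.aeval ((AddMonoidAlgebra.single ((0 : ℤ), (0 : ℤ)) (-(μ : ℂ)) - AddMonoidAlgebra.single ((1 : ℤ), (0 : ℤ)) (1 : ℂ)
          - AddMonoidAlgebra.single ((-1 : ℤ), (0 : ℤ)) (1 : ℂ) - AddMonoidAlgebra.single ((0 : ℤ), (1 : ℤ)) (1 : ℂ)
          - AddMonoidAlgebra.single ((0 : ℤ), (-1 : ℤ)) (1 : ℂ)) *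
        (AddMonoidAlgebra.single ((0 : ℤ), (0 : ℤ)) (-(μ : ℂ)) - AddMonoidAlgebra.single ((1 : ℤ), (0 : ℤ)) (1 : ℂ)
          - AddMonoidAlgebra.single ((-1 : ℤ), (0 : ℤ)) (1 : ℂ) - AddMonoidAlgebra.single ((0 : ℤ), (1 : ℤ)) (1 : ℂ)
          - AddMonoidAlgebra.single ((0 : ℤ), (-1 : ℤ)) (1 : ℂ)) +
        (∑ r ∈ ({(1, 0), (-1, 0), (0, 1), (0, -1), (1, 1), (-1, -1), (1, -1), (-1, 1)} : Finset (ℤ × ℤ)), AddMonoidAlgebra.single r ((fun r : ℤ × ℤ => if (r = (1, 0) ∨ r = (-1, 0)) then (Δ₁ : ℂ) else if (r = (0, 1) ∨ r = (0, -1)) then -(Δ₁ : ℂ)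
          else if (r = (1, 1) ∨ r = (-1, -1)) then Complex.I * (Δ₂ : ℂ) else -(Complex.I * (Δ₂ : ℂ))) r)) *
        (∑ r ∈ ({(1, 0), (-1, 0), (0, 1), (0, -1), (1, 1), (-1, -1), (1, -1), (-1, 1)} : Finset (ℤ × ℤ)), AddMonoidAlgebra.single (-r) (conj ((fun r : ℤ × ℤ => if (r = (1, 0) ∨ r = (-1, 0)) then (Δ₁ : ℂ) else if (r = (0, 1) ∨ r = (0, -1)) then -(Δ₁ : ℂ)
          else if (r = (1, 1) ∨ r = (-1, -1)) then Complex.I * (Δ₂ : ℂ) else -(Complex.I * (Δ₂ : ℂ))) r)))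
        : AddMonoidAlgebra ℂ (ℤ × ℤ)) (P.map (algebraMap ℝ ℂ))).coeff.support,
        (Polynomial.aeval ((AddMonoidAlgebra.single ((0 : ℤ), (0 : ℤ)) (-(μ : ℂ)) - AddMonoidAlgebra.single ((1 : ℤ), (0 : ℤ)) (1 : ℂ)
          - AddMonoidAlgebra.single ((-1 : ℤ), (0 : ℤ)) (1 : ℂ) - AddMonoidAlgebra.single ((0 : ℤ), (1 : ℤ)) (1 : ℂ)
          - AddMonoidAlgebra.single ((0 : ℤ), (-1 : ℤ)) (1 : ℂ)) *
        (AddMonoidAlgebra.single ((0 : ℤ), (0 : ℤ)) (-(μ : ℂ)) - AddMonoidAlgebra.single ((1 : ℤ), (0 : ℤ)) (1 : ℂ)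
          - AddMonoidAlgebra.single ((-1 : ℤ), (0 : ℤ)) (1 : ℂ) - AddMonoidAlgebra.single ((0 : ℤ), (1 : ℤ)) (1 : ℂ)
          - AddMonoidAlgebra.single ((0 : ℤ), (-1 : ℤ)) (1 : ℂ)) +
        (∑ r ∈ ({(1, 0), (-1, 0), (0, 1), (0, -1), (1, 1), (-1, -1), (1, -1), (-1, 1)} : Finset (ℤ × ℤ)), AddMonoidAlgebra.single r ((fun r : ℤ × ℤ => if (r = (1, 0) ∨ r = (-1, 0)) then (Δ₁ : ℂ) else if (r = (0, 1) ∨ r = (0, -1)) then -(Δ₁ : ℂ)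
          else if (r = (1, 1) ∨ r = (-1, -1)) then Complex.I * (Δ₂ : ℂ) else -(Complex.I * (Δ₂ : ℂ))) r)) *
        (∑ r ∈ ({(1, 0), (-1, 0), (0, 1), (0, -1), (1, 1), (-1, -1), (1, -1), (-1, 1)} : Finset (ℤ × ℤ)), AddMonoidAlgebra.single (-r) (conj ((fun r : ℤ × ℤ => if (r = (1, 0) ∨ r = (-1, 0)) then (Δ₁ : ℂ) else if (r = (0, 1) ∨ r = (0, -1)) then -(Δ₁ : ℂ)
          else if (r = (1, 1) ∨ r = (-1, -1)) then Complex.I * (Δ₂ : ℂ) else -(Complex.I * (Δ₂ : ℂ))) r)))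
        : AddMonoidAlgebra ℂ (ℤ × ℤ)) (P.map (algebraMap ℝ ℂ))).coeff ρ *
          Complex.exp (Complex.I * ((ρ.1 * θ₀ + ρ.2 * θ₁ : ℝ) : ℂ)) =
      ((P.eval y : ℝ) : ℂ) := by
    have h1 := lift_eq_sum_support F (Polynomial.aeval ((AddMonoidAlgebra.single ((0 : ℤ), (0 : ℤ)) (-(μ : ℂ)) - AddMonoidAlgebra.single ((1 : ℤ), (0 : ℤ)) (1 : ℂ)
          - AddMonoidAlgebra.single ((-1 : ℤ), (0 : ℤ)) (1 : ℂ) - AddMonoidAlgebra.single ((0 : ℤ), (1 : ℤ)) (1 : ℂ)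
          - AddMonoidAlgebra.single ((0 : ℤ), (-1 : ℤ)) (1 : ℂ)) *
        (AddMonoidAlgebra.single ((0 : ℤ), (0 : ℤ)) (-(μ : ℂ)) - AddMonoidAlgebra.single ((1 : ℤ), (0 : ℤ)) (1 : ℂ)
          - AddMonoidAlgebra.single ((-1 : ℤ), (0 : ℤ)) (1 : ℂ) - AddMonoidAlgebra.single ((0 : ℤ), (1 : ℤ)) (1 : ℂ)
          - AddMonoidAlgebra.single ((0 : ℤ), (-1 : ℤ)) (1 : ℂ)) +
        (∑ r ∈ ({(1, 0), (-1, 0), (0, 1), (0, -1), (1, 1), (-1, -1), (1, -1), (-1, 1)} : Finset (ℤ × ℤ)), AddMonoidAlgebra.single r ((fun r : ℤ × ℤ => if (r = (1, 0) ∨ r = (-1, 0)) then (Δ₁ : ℂ) else if (r = (0, 1) ∨ r = (0, -1)) then -(Δ₁ : ℂ)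
          else if (r = (1, 1) ∨ r = (-1, -1)) then Complex.I * (Δ₂ : ℂ) else -(Complex.I * (Δ₂ : ℂ))) r)) *
        (∑ r ∈ ({(1, 0), (-1, 0), (0, 1), (0, -1), (1, 1), (-1, -1), (1, -1), (-1, 1)} : Finset (ℤ × ℤ)), AddMonoidAlgebra.single (-r) (conj ((fun r : ℤ × ℤ => if (r = (1, 0) ∨ r = (-1, 0)) then (Δ₁ : ℂ) else if (r = (0, 1) ∨ r = (0, -1)) then -(Δ₁ : ℂ)
          else if (r = (1, 1) ∨ r = (-1, -1)) then Complex.I * (Δ₂ : ℂ) else -(Complex.I * (Δ₂ : ℂ))) r)))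
        : AddMonoidAlgebra ℂ (ℤ × ℤ)) (P.map (algebraMap ℝ ℂ)))
    simp_rw [hF] at h1
    rw [← h1, ← Polynomial.aeval_algHom_apply, hEv, Polynomial.aeval_map_algebraMap,
      show ((y : ℝ) : ℂ) = algebraMap ℝ ℂ y from rfl, Polynomial.aeval_algebraMap_apply_eq_algebraMap_eval]
    rfl
  rw [hsum, ← Complex.ofReal_sub, Complex.norm_real, Real.norm_eq_abs]
  exact hP y (hrange θ₀ θ₁)

/-! ### Frequency boxes of elements of `ℂ[ℤ²]` -/

section Box

/-- Products add frequency boxes. [folklore] -/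
theorem box_mul {x y : AddMonoidAlgebra ℂ (ℤ × ℤ)} {m n : ℤ}
    (hx : ∀ ρ ∈ x.coeff.support, |ρ.1| ≤ m ∧ |ρ.2| ≤ m) (hy : ∀ ρ ∈ y.coeff.support, |ρ.1| ≤ n ∧ |ρ.2| ≤ n) :
    ∀ ρ ∈ (x * y).coeff.support, |ρ.1| ≤ m + n ∧ |ρ.2| ≤ m + n := by
  classical
  intro ρ hρ
  have h := AddMonoidAlgebra.support_coeff_mul_subset x y hρ
  rw [Finset.mem_add] at h
  obtain ⟨b, hb, c, hc, rfl⟩ := h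
  obtain ⟨hb1, hb2⟩ := hx b hb
  obtain ⟨hc1, hc2⟩ := hy c hc
  simp only [Prod.fst_add, Prod.snd_add]
  exact ⟨(abs_add_le _ _).trans (add_le_add hb1 hc1), (abs_add_le _ _).trans (add_le_add hb2 hc2)⟩

/-- Sums stay in the larger box. [folklore] -/
theorem box_add {x y : AddMonoidAlgebra ℂ (ℤ × ℤ)} {n : ℤ}
    (hx : ∀ ρ ∈ x.coeff.support, |ρ.1| ≤ n ∧ |ρ.2| ≤ n) (hy : ∀ ρ ∈ y.coeff.support, |ρ.1| ≤ n ∧ |ρ.2| ≤ n) :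
    ∀ ρ ∈ (x + y).coeff.support, |ρ.1| ≤ n ∧ |ρ.2| ≤ n := by
  intro ρ hρ
  rw [AddMonoidAlgebra.coeff_add] at hρ
  rcases Finset.mem_union.1 (Finsupp.support_add hρ) with h | h
  · exact hx ρ h
  · exact hy ρ h

/-- Differences stay in the larger box. [folklore] -/
theorem box_sub {x y : AddMonoidAlgebra ℂ (ℤ × ℤ)} {n : ℤ}
    (hx : ∀ ρ ∈ x.coeff.support, |ρ.1| ≤ n ∧ |ρ.2| ≤ n) (hy : ∀ ρ ∈ y.coeff.support, |ρ.1| ≤ n ∧ |ρ.2| ≤ n) :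
    ∀ ρ ∈ (x - y).coeff.support, |ρ.1| ≤ n ∧ |ρ.2| ≤ n := by
  intro ρ hρ
  rw [AddMonoidAlgebra.coeff_sub] at hρ
  rcases Finset.mem_union.1 (Finsupp.support_sub hρ) with h | h
  · exact hx ρ h
  · exact hy ρ h

/-- A `single` lives in the box of its frequency. [folklore] -/
theorem box_single (σ : ℤ × ℤ) (c : ℂ) {n : ℤ} (h1 : |σ.1| ≤ n) (h2 : |σ.2| ≤ n) :
    ∀ ρ ∈ (AddMonoidAlgebra.single σ c : AddMonoidAlgebra ℂ (ℤ × ℤ)).coeff.support, |ρ.1| ≤ n ∧ |ρ.2| ≤ n := by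
  intro ρ hρ
  rw [AddMonoidAlgebra.coeff_single] at hρ
  have := Finsupp.support_single_subset hρ
  rw [Finset.mem_singleton] at this
  subst this
  exact ⟨h1, h2⟩

/-- Finite sums stay in a common box. [folklore] -/
theorem box_sum {ι : Type*} (t : Finset ι) (f : ι → AddMonoidAlgebra ℂ (ℤ × ℤ)) {n : ℤ}
    (h : ∀ i ∈ t, ∀ ρ ∈ (f i).coeff.support, |ρ.1| ≤ n ∧ |ρ.2| ≤ n) :
    ∀ ρ ∈ (∑ i ∈ t, f i).coeff.support, |ρ.1| ≤ n ∧ |ρ.2| ≤ n := by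
  classical
  intro ρ hρ
  rw [AddMonoidAlgebra.coeff_sum] at hρ
  obtain ⟨i, hi, hρi⟩ := Finset.mem_biUnion.1 (Finsupp.support_finsetSum hρ)
  exact h i hi ρ hρi

/-- Scalar multiples stay in the box. [folklore] -/
theorem box_smul (c : ℂ) {x : AddMonoidAlgebra ℂ (ℤ × ℤ)} {n : ℤ}
    (hx : ∀ ρ ∈ x.coeff.support, |ρ.1| ≤ n ∧ |ρ.2| ≤ n) :
    ∀ ρ ∈ (c • x).coeff.support, |ρ.1| ≤ n ∧ |ρ.2| ≤ n := by
  intro ρ hρ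
  rw [AddMonoidAlgebra.coeff_smul] at hρ
  exact hx ρ (Finsupp.support_smul hρ)

/-- Powers multiply the box. [folklore] -/
theorem box_pow {x : AddMonoidAlgebra ℂ (ℤ × ℤ)} {m : ℤ}
    (hx : ∀ ρ ∈ x.coeff.support, |ρ.1| ≤ m ∧ |ρ.2| ≤ m) :
    ∀ j : ℕ, ∀ ρ ∈ (x ^ j).coeff.support, |ρ.1| ≤ j * m ∧ |ρ.2| ≤ j * m := by
  intro j
  induction j with
  | zero =>
    intro ρ hρ
    rw [pow_zero, AddMonoidAlgebra.one_def] at hρ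
    have := box_single ((0 : ℤ), (0 : ℤ)) (1 : ℂ) (n := 0) (by simp) (by simp) ρ hρ
    simpa using this
  | succ j ih =>
    intro ρ hρ
    rw [pow_succ] at hρ
    have := box_mul ih hx ρ hρ
    push_cast
    constructor <;> linarith [this.1, this.2]

end Box

/-! ### The support of `P(E2A)` -/

/-- `E2A` has frequencies in the box `[-2, 2]²`. [folklore] -/
theorem box_E2A (μ Δ₁ Δ₂ : ℝ) :
    ∀ ρ ∈ (((AddMonoidAlgebra.single ((0 : ℤ), (0 : ℤ)) (-(μ : ℂ)) - AddMonoidAlgebra.single ((1 : ℤ), (0 : ℤ)) (1 : ℂ)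
          - AddMonoidAlgebra.single ((-1 : ℤ), (0 : ℤ)) (1 : ℂ) - AddMonoidAlgebra.single ((0 : ℤ), (1 : ℤ)) (1 : ℂ)
          - AddMonoidAlgebra.single ((0 : ℤ), (-1 : ℤ)) (1 : ℂ)) *
        (AddMonoidAlgebra.single ((0 : ℤ), (0 : ℤ)) (-(μ : ℂ)) - AddMonoidAlgebra.single ((1 : ℤ), (0 : ℤ)) (1 : ℂ)
          - AddMonoidAlgebra.single ((-1 : ℤ), (0 : ℤ)) (1 : ℂ) - AddMonoidAlgebra.single ((0 : ℤ), (1 : ℤ)) (1 : ℂ)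
          - AddMonoidAlgebra.single ((0 : ℤ), (-1 : ℤ)) (1 : ℂ)) +
        (∑ r ∈ ({(1, 0), (-1, 0), (0, 1), (0, -1), (1, 1), (-1, -1), (1, -1), (-1, 1)} : Finset (ℤ × ℤ)), AddMonoidAlgebra.single r ((fun r : ℤ × ℤ => if (r = (1, 0) ∨ r = (-1, 0)) then (Δ₁ : ℂ) else if (r = (0, 1) ∨ r = (0, -1)) then -(Δ₁ : ℂ)
          else if (r = (1, 1) ∨ r = (-1, -1)) then Complex.I * (Δ₂ : ℂ) else -(Complex.I * (Δ₂ : ℂ))) r)) *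
        (∑ r ∈ ({(1, 0), (-1, 0), (0, 1), (0, -1), (1, 1), (-1, -1), (1, -1), (-1, 1)} : Finset (ℤ × ℤ)), AddMonoidAlgebra.single (-r) (conj ((fun r : ℤ × ℤ => if (r = (1, 0) ∨ r = (-1, 0)) then (Δ₁ : ℂ) else if (r = (0, 1) ∨ r = (0, -1)) then -(Δ₁ : ℂ)
          else if (r = (1, 1) ∨ r = (-1, -1)) then Complex.I * (Δ₂ : ℂ) else -(Complex.I * (Δ₂ : ℂ))) r)))
        : AddMonoidAlgebra ℂ (ℤ × ℤ))).coeff.support, |ρ.1| ≤ 2 ∧ |ρ.2| ≤ 2 := by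
  have hξ : ∀ ρ ∈ ((AddMonoidAlgebra.single ((0 : ℤ), (0 : ℤ)) (-(μ : ℂ)) - AddMonoidAlgebra.single ((1 : ℤ), (0 : ℤ)) (1 : ℂ)
          - AddMonoidAlgebra.single ((-1 : ℤ), (0 : ℤ)) (1 : ℂ) - AddMonoidAlgebra.single ((0 : ℤ), (1 : ℤ)) (1 : ℂ)
          - AddMonoidAlgebra.single ((0 : ℤ), (-1 : ℤ)) (1 : ℂ) : AddMonoidAlgebra ℂ (ℤ × ℤ))).coeff.support,
      |ρ.1| ≤ 1 ∧ |ρ.2| ≤ 1 :=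
    box_sub (box_sub (box_sub (box_sub (box_single _ _ (by simp) (by simp)) (box_single _ _ (by simp) (by simp)))
      (box_single _ _ (by simp) (by simp))) (box_single _ _ (by simp) (by simp))) (box_single _ _ (by simp) (by simp))
  have hB : ∀ r ∈ ({(1, 0), (-1, 0), (0, 1), (0, -1), (1, 1), (-1, -1), (1, -1), (-1, 1)} : Finset (ℤ × ℤ)), |r.1| ≤ 1 ∧ |r.2| ≤ 1 := by
    intro r hr
    simp only [Finset.mem_insert, Finset.mem_singleton] at hr
    rcases hr with rfl | rfl | rfl | rfl | rfl | rfl | rfl | rfl <;> simp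
  have hΔ : ∀ ρ ∈ (∑ r ∈ ({(1, 0), (-1, 0), (0, 1), (0, -1), (1, 1), (-1, -1), (1, -1), (-1, 1)} : Finset (ℤ × ℤ)), AddMonoidAlgebra.single r ((fun r : ℤ × ℤ => if (r = (1, 0) ∨ r = (-1, 0)) then (Δ₁ : ℂ) else if (r = (0, 1) ∨ r = (0, -1)) then -(Δ₁ : ℂ)
          else if (r = (1, 1) ∨ r = (-1, -1)) then Complex.I * (Δ₂ : ℂ) else -(Complex.I * (Δ₂ : ℂ))) r)).coeff.support, |ρ.1| ≤ 1 ∧ |ρ.2| ≤ 1 :=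
    box_sum _ _ fun r hr => box_single _ _ (hB r hr).1 (hB r hr).2
  have hΔs : ∀ ρ ∈ (∑ r ∈ ({(1, 0), (-1, 0), (0, 1), (0, -1), (1, 1), (-1, -1), (1, -1), (-1, 1)} : Finset (ℤ × ℤ)), AddMonoidAlgebra.single (-r) (conj ((fun r : ℤ × ℤ => if (r = (1, 0) ∨ r = (-1, 0)) then (Δ₁ : ℂ) else if (r = (0, 1) ∨ r = (0, -1)) then -(Δ₁ : ℂ)
          else if (r = (1, 1) ∨ r = (-1, -1)) then Complex.I * (Δ₂ : ℂ) else -(Complex.I * (Δ₂ : ℂ))) r))).coeff.support,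
      |ρ.1| ≤ 1 ∧ |ρ.2| ≤ 1 :=
    box_sum _ _ fun r hr => box_single _ _ (by simpa using (hB r hr).1) (by simpa using (hB r hr).2)
  have h := box_add (box_mul hξ hξ) (box_mul hΔ hΔs)
  intro ρ hρ
  obtain ⟨h1, h2⟩ := h ρ hρ
  constructor <;> linarith

/-- **The support of `P(E2A)`**: the coefficients `a := (aeval E2A (P.map ofReal)).coeff` have frequencies
in the box `[-2 deg P, 2 deg P]²` (hypothesis `hsupp` of `BirBdG.symbolIneq_dplusid_of_realData` with
`D = 2 deg P`). [folklore] -/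
theorem support_aeval_E2A (P : Polynomial ℝ) (μ Δ₁ Δ₂ : ℝ) :
    ∀ ρ ∈ (Polynomial.aeval ((AddMonoidAlgebra.single ((0 : ℤ), (0 : ℤ)) (-(μ : ℂ)) - AddMonoidAlgebra.single ((1 : ℤ), (0 : ℤ)) (1 : ℂ)
          - AddMonoidAlgebra.single ((-1 : ℤ), (0 : ℤ)) (1 : ℂ) - AddMonoidAlgebra.single ((0 : ℤ), (1 : ℤ)) (1 : ℂ)
          - AddMonoidAlgebra.single ((0 : ℤ), (-1 : ℤ)) (1 : ℂ)) *
        (AddMonoidAlgebra.single ((0 : ℤ), (0 : ℤ)) (-(μ : ℂ)) - AddMonoidAlgebra.single ((1 : ℤ), (0 : ℤ)) (1 : ℂ)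
          - AddMonoidAlgebra.single ((-1 : ℤ), (0 : ℤ)) (1 : ℂ) - AddMonoidAlgebra.single ((0 : ℤ), (1 : ℤ)) (1 : ℂ)
          - AddMonoidAlgebra.single ((0 : ℤ), (-1 : ℤ)) (1 : ℂ)) +
        (∑ r ∈ ({(1, 0), (-1, 0), (0, 1), (0, -1), (1, 1), (-1, -1), (1, -1), (-1, 1)} : Finset (ℤ × ℤ)), AddMonoidAlgebra.single r ((fun r : ℤ × ℤ => if (r = (1, 0) ∨ r = (-1, 0)) then (Δ₁ : ℂ) else if (r = (0, 1) ∨ r = (0, -1)) then -(Δ₁ : ℂ)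
          else if (r = (1, 1) ∨ r = (-1, -1)) then Complex.I * (Δ₂ : ℂ) else -(Complex.I * (Δ₂ : ℂ))) r)) *
        (∑ r ∈ ({(1, 0), (-1, 0), (0, 1), (0, -1), (1, 1), (-1, -1), (1, -1), (-1, 1)} : Finset (ℤ × ℤ)), AddMonoidAlgebra.single (-r) (conj ((fun r : ℤ × ℤ => if (r = (1, 0) ∨ r = (-1, 0)) then (Δ₁ : ℂ) else if (r = (0, 1) ∨ r = (0, -1)) then -(Δ₁ : ℂ)
          else if (r = (1, 1) ∨ r = (-1, -1)) then Complex.I * (Δ₂ : ℂ) else -(Complex.I * (Δ₂ : ℂ))) r)))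
        : AddMonoidAlgebra ℂ (ℤ × ℤ)) (P.map (algebraMap ℝ ℂ))).coeff.support,
      |ρ.1| ≤ ((2 * P.natDegree : ℕ) : ℤ) ∧ |ρ.2| ≤ ((2 * P.natDegree : ℕ) : ℤ) := by
  have hdeg : (P.map (algebraMap ℝ ℂ)).natDegree = P.natDegree :=
    Polynomial.natDegree_map_eq_of_injective (algebraMap ℝ ℂ).injective P
  rw [Polynomial.aeval_eq_sum_range, hdeg]
  refine box_sum _ _ fun i hi => box_smul _ fun ρ hρ => ?_
  have hpow := box_pow (m := 2) (box_E2A μ Δ₁ Δ₂) i ρ hρ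
  have hi' : (i : ℤ) ≤ P.natDegree := by
    have := Finset.mem_range.1 hi
    exact_mod_cast Nat.lt_succ_iff.1 this
  push_cast
  constructor <;> nlinarith [hpow.1, hpow.2, abs_nonneg ρ.1, abs_nonneg ρ.2]

end BirBdG

end Summit.HubbardSuperconductivity.HubbardSuperconductivity.Theorems

end
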